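/-
Copyright (c) 2026 the pub-hodgecm-mathlib formalisation cell (harness21).  Prover seat hodgecm-mathlib-K2E3-p31 (g2) on F4 DEAL K2Liu-p27 (g2) 2026-09-05T00:09:50Z,
Track B «K2-LIT» ∕ hLiu418 #184♮ = `stmt-HodgeConjecture-24832`, Road I v3 U5 «THE CLOSE» — FACE-G organ (G-gen) = F4, road (E), B3-b: the (dom) + (vac) CLOSERS of
★ FILE 2b `K2LiuArchSWDataInduction.good_tupleVec_of_frame` (LH7-p07 (g2)).  Consumer LH7-p07 FILE 2c∕2d; box audit1.  THEOREMS ONLY (no `def`, no `instance`,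
no notation, no named-fact hypothesis, no `sorry`); lane `--supports stmt-HodgeConjecture-24832 --as helper`.
-/
import Summits.HodgeConjecture.HodgeConjecture.Theorems.K2LiuArchSWDataInduction        -- ★ FILE 2b (LH7-p07): the (dom)∕(vac) binder bytes, `tupleVec` (★ FILE 1), `IsArchStable` (★ FaceGLetterDefs)
import Summits.HodgeConjecture.HodgeConjecture.Theorems.K2LiuArchSWSpanningDefs         -- ★ S2-D: `IsArchDatum` (the currency of ★ σ15 `isArchDatum_hermiteSpan`)
import Summits.HodgeConjecture.HodgeConjecture.Theorems.K2LiuArchWeilFockDerivatives     -- ★ `binvPi_monomial` (`B⁻¹(c z^β) = (c · hcoef⁻¹) • h_β`)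
import Summits.HodgeConjecture.HodgeConjecture.Theorems.K2LiuArchGaussianOfRecord        -- ★ LH7-p05: `archGaussianOfRecord` (`v_G`), `HLrecOfRecord`, `holCutOfRecord`
import HarnessLib

/-!
# Crux `HLiu418`, F4 road (E), B3-b: the (dom) and (vac) letters of `good_tupleVec_of_frame` from the Hermite-span degree ledger

Cell `hodgecm-mathlib`, crux item hLiu418 = `stmt-HodgeConjecture-24832` (helper lane `--supports`, count-neutral; closes no socket).

THE SOCKET.  ★ FILE 2b `K2LiuArchSWDataInduction.good_tupleVec_of_frame` (and `vac_good_of_base`) carry two domain letters BY VALUE: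
* (dom) `∀ s : Finset (Π σ, ℂ[Fock_σ]), ∃ V′, FiniteDimensional ℂ V′ ∧ IsArchStable … 𝒦 V′ ∧ ∀ β ∈ s, tupleVec … β ∈ V′` — every finite set of tuple vectors lies in SOME
  finite-dimensional arch-stable subspace;
* (vac) `∃ V₀, FiniteDimensional ℂ V₀ ∧ IsArchStable … 𝒦 V₀ ∧ HL₀ V₀ ∧ tupleVec … 1 ∈ V₀` — some admissible HOL-CUT domain contains the all-vacuum tuple vector (= ★
  `archGaussianOfRecord`, `v_G`), at `HL₀ :=` the hol cut of record (★ LH7-p05 `HLrecOfRecord` = `holCutOfRecord … ` = «`V₀ = ℂ ∙ v_G`», ★ `holCutOfRecord_iff`).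
THIS FILE pays both from ONE letter: «the Hermite spans `V_D := span {follandHermite frameD γ : |γ| ≤ D}` of the big scaled Folland frame are arch data for `𝒦`»
(`hdat : ∀ D, IsArchDatum … (doubledWeilRep …) 𝒦 V_D`) — which is ★ σ15 `K2LiuArchHermiteDatum.isArchDatum_hermiteSpan … 𝒦 hK D` for every `𝒦` whose archimedean
compact part is generated by the one-place sign-frame compacts (its closure letter `hK`, the same letter ★ #42S's closing file `K2LiuArchSWSpanningStd` carries as `hK₀`):
* §1 **`binvPi_mem_span_hermitePi`** — THE DEGREE LEDGER at the Fock level: `B⁻¹F ∈ span {h_γ : |γ| ≤ D}` for `deg F ≤ D` (`F = Σ_γ c_γ z^γ`, ★ `binvPi_monomial`, `MvPolynomial.le_totalDegree`);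
  **`tupleVec_mem_hermiteSpan`** — `tupleVec a ∈ V_D` for `D ≥ deg (tuplePoly a)` (`tupleVec a = frameD^*⁻¹ B⁻¹(tuplePoly a)`, ★ FILE 1; `follandHermite frameD γ = frameD^*⁻¹ h_γ`).
* §2 **`isArchStable_of_isArchDatum`** (`IsArchDatum … (doubledWeilRep …) 𝒦 V → IsArchStable … 𝒦 V`, definitional); **`hdom_of_hermiteData`** — (dom) from `hdat` (`D :=` the max of
  `deg (tuplePoly β)` over `β ∈ s`).
* §3 **`tupleVec_one_eq_archGaussianOfRecord`** (`tupleVec 1 = v_G`, ★ `tupleVecOf_one` + ★ `archGaussianOfRecord_eq_follandHermite`); **`hermiteSpan_zero_eq_span_archGaussian`**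
  (`V_0 = ℂ ∙ v_G`: `|γ| ≤ 0 ⇔ γ = 0`); **`hHL_of_hermiteData`** — (vac) at `HL₀ := HLrecOfRecord …` (= `holCutOfRecord …` applied, same term) from `hdat 0`, with `V₀ := ℂ ∙ v_G`.
At the tie: `hdat := fun D => K2LiuArchHermiteDatum.isArchDatum_hermiteSpan L e dV hdV hdV0 dW hdW hdW0 eW e' dV' hdV' hdV'0 hχbu hχbs (isDoubledWeilRep_doubledWeilRep …) ht hodd
y hy hz eP′ eQ′ hE′ 𝒦 hK D` (K2E5-p16's junction frame of record ★ `exists_junctionFrameData`; `hK` by value until the standard-`𝒦` compact letter lands).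
References: [Folland1989] G. B. Folland, Harmonic Analysis in Phase Space, §1.7 (1.81), §4.2 Prop. (4.39); [Howe1989] R. Howe, Remarks on classical invariant theory,
§3 (K-finite vectors = polynomial × Gaussian); [HarrisKudlaSweet1996] §1 (1.15)–(1.17); [KudlaRallis1994] §3; [Liu2021] App. B proof of Prop. B.8 pp. 103–106.
HONEST LABEL: HC_CM is proved only modulo the 7 printed citations (2 remaining named inputs: hLiu418 = stmt-HodgeConjecture-24832,
h413 = stmt-HodgeConjecture-24833) until rung 0 closes; count-neutral helper, closes no socket.
-/

set_option autoImplicit false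
set_option linter.dupNamespace false -- the mandated namespace repeats `HodgeConjecture.HodgeConjecture`

noncomputable section

open scoped Classical Matrix MatrixGroups TensorProduct Kronecker SchwartzMap
open MvPolynomial
open NumberField NumberField.InfinitePlace NumberField.mixedEmbedding IsDedekindDomain
open Literature.Analysis.SegalBargmann Literature.RepresentationTheory.HeisenbergGroup
open Literature.NumberTheory.Automorphic Literature.NumberTheory.Automorphic.UnitaryGroup Literature.NumberTheory.GaloisRepresentations
open Literature.NumberTheory.Weil1964 Literature.NumberTheory.Weil1964.MpS Literature.NumberTheory.Weil1964.UnitaryWeil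
open Literature.RepresentationTheory.HarrisKudlaSweet1996
open Literature.RepresentationTheory.KonnoKonno2007 Literature.RepresentationTheory.KonnoKonno2007.RealDualPair
open Literature.NumberTheory.GelbartRogawski1991 Literature.NumberTheory.GelbartRogawski1991.GRConstruction
open Literature.NumberTheory.GelbartRogawski1991.UnitaryDualPair
open Literature.NumberTheory.GelbartRogawski1991.UnitaryDualPair.LocalSplitting
open Literature.NumberTheory.K2Lit.SiegelDoubled
open Literature.NumberTheory.Automorphic.Liu2021.Def411WeilCarriersDoubling
open Summit.HodgeConjecture.HodgeConjecture.Cruxes.HLiu418.K2LiuArchSectionPlaceBlock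
open Summit.HodgeConjecture.HodgeConjecture.Cruxes.HLiu418.K2LiuFaceGLetterDefs (IsArchStable)
open Summit.HodgeConjecture.HodgeConjecture.Cruxes.HLiu418.K2LiuArchSWDataTuplesDefs
open Summit.HodgeConjecture.HodgeConjecture.Cruxes.HLiu418.K2LiuArchSWSpanningDefs (IsArchDatum)
open Summit.HodgeConjecture.HodgeConjecture.Cruxes.HLiu418.K2LiuArchWeilFockDerivatives (binvPi_monomial)
open Summit.HodgeConjecture.HodgeConjecture.Cruxes.HLiu418.K2LiuArchGaussianOfRecord (archGaussianOfRecord HLrecOfRecord)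

namespace Summit.HodgeConjecture.HodgeConjecture.Cruxes.HLiu418.K2LiuArchSWDataDomainLetters

/-! ## §1 The degree ledger: `B⁻¹F` and the tuple vectors lie in the Hermite spans -/

/-- **THE DEGREE LEDGER AT THE FOCK LEVEL**: `B⁻¹F ∈ span {h_γ : |γ| ≤ D}` whenever `deg F ≤ D` (`F = Σ_{γ ∈ supp F} c_γ z^γ`, `B⁻¹(c z^γ) = (c · hcoef γ⁻¹) • h_γ` ★ `binvPi_monomial`,
`|γ| ≤ deg F` for `γ ∈ supp F` `MvPolynomial.le_totalDegree`). [cite: Folland1989, §1.7 (1.81)] [cite: Howe1989, §3] -/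
theorem binvPi_mem_span_hermitePi {σ : Type} [Fintype σ] [DecidableEq σ] (D : ℕ) (F : MvPolynomial σ ℂ) (hF : F.totalDegree ≤ D) :
    (binvPi F : SchwartzMap (σ → ℝ) ℂ) ∈ Submodule.span ℂ {x : SchwartzMap (σ → ℝ) ℂ | ∃ γ : σ →₀ ℕ, γ.degree ≤ D ∧ hermitePi γ = x} := by
  rw [F.as_sum, ← binvPiₗ_apply, map_sum]
  refine Submodule.sum_mem _ fun γ hγ => ?_
  rw [binvPiₗ_apply, binvPi_monomial]
  refine Submodule.smul_mem _ _ (Submodule.subset_span ⟨γ, ?_, rfl⟩)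
  exact (MvPolynomial.le_totalDegree hγ).trans hF

section BigDatum

variable (L : Type) [Field L] [NumberField L] [IsCMField L] {n : ℕ} (e : Fin 2 × Fin 1 ≃ Fin n)
  (dV : Fin 2 → L) (hdV : ∀ i, IsCMField.complexConj L (dV i) = dV i) (hdV0 : ∀ i, dV i ≠ 0)
  (dW : Fin 1 → L) (hdW : ∀ i, IsCMField.complexConj L (dW i) = dW i) (hdW0 : ∀ i, dW i ≠ 0)
  {M' n' : ℕ} (eW : Fin 1 × Fin 3 ≃ Fin M') (e' : Fin 2 × Fin M' ≃ Fin n')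
  (dV' : Fin 3 → L) (hdV' : ∀ k, IsCMField.complexConj L (dV' k) = dV' k) (hdV'0 : ∀ k, dV' k ≠ 0)
  (χb : HeckeCharacter L) (hχbu : χb.IsUnitary) (hχbs : Literature.RepresentationTheory.HarrisKudlaSweet1996.IsSplittingChar L 1 χb)
  (𝒦 : IwasawaDatum L e dV hdV dW hdW)
  {P Q : Type} [Fintype P] [DecidableEq P] [Fintype Q] [DecidableEq Q]
  (R S : {v : InfinitePlace (Fp L) // v.IsReal} → Type) [∀ σ, Fintype (R σ)] [∀ σ, DecidableEq (R σ)] [∀ σ, Fintype (S σ)] [∀ σ, DecidableEq (S σ)]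
  (eP : ∀ σ : {v : InfinitePlace (Fp L) // v.IsReal}, PosIdx (signVec (cmPlaceOver L) (fun k => Sum.elim (cmGramEntry L e' dV hdV (tensorFrame L dW eW dV') (tensorFrame_real L dW hdW eW dV' hdV')) (-cmGramEntry L e' dV hdV (tensorFrame L dW eW dV') (tensorFrame_real L dW hdW eW dV' hdV')) ((LocalSplitting.e₂ n').symm k)) (imagUnit L) σ) ≃ (P × R σ) ⊕ (Q × S σ))
  (eQ : ∀ σ : {v : InfinitePlace (Fp L) // v.IsReal}, NegIdx (signVec (cmPlaceOver L) (fun k => Sum.elim (cmGramEntry L e' dV hdV (tensorFrame L dW eW dV') (tensorFrame_real L dW hdW eW dV' hdV')) (-cmGramEntry L e' dV hdV (tensorFrame L dW eW dV') (tensorFrame_real L dW hdW eW dV' hdV')) ((LocalSplitting.e₂ n').symm k)) (imagUnit L) σ) ≃ (P × S σ) ⊕ (Q × R σ))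

-- the CM sign frames of the big datum elaborate slowly (as ★ FILE 1∕2b: 4 000 000 heartbeats for the statements)
set_option maxHeartbeats 4000000

omit [Fintype P] [DecidableEq P] [Fintype Q] [DecidableEq Q] [∀ σ, Fintype (R σ)] [∀ σ, DecidableEq (R σ)] [∀ σ, Fintype (S σ)] [∀ σ, DecidableEq (S σ)] in
/-- **THE TUPLE VECTORS LIE IN THE HERMITE SPANS**: `tupleVec a ∈ V_D = span {follandHermite frameD γ : |γ| ≤ D}` as soon as `deg (tuplePoly a) ≤ D` — `tupleVec a =
frameD^*⁻¹ (B⁻¹ (tuplePoly a))` (★ FILE 1 `tupleVecOf`) and `follandHermite frameD γ = frameD^*⁻¹ h_γ`, so §1 transports along the frame (`frameD^*⁻¹` injective).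
[cite: Folland1989, §1.7 (1.81), §4.2 Prop. (4.39)] [cite: Howe1989, §3] -/
theorem tupleVec_mem_hermiteSpan (a : (σ : {v : InfinitePlace (Fp L) // v.IsReal}) → MvPolynomial (DPIdx P Q (R σ) (S σ)) ℂ) (D : ℕ)
    (hD : (tuplePoly (fun σ => unitJunctionIdx ((P × R σ) ⊕ (Q × S σ)) ((P × S σ) ⊕ (Q × R σ)))
      (frameSlotEquiv L dV hdV dW hdW eW e' dV' hdV' R S eP eQ) a).totalDegree ≤ D) :
    tupleVec L dV hdV hdV0 dW hdW hdW0 eW e' dV' hdV' hdV'0 R S eP eQ a ∈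
      Submodule.span ℂ {x : 𝓢((Fin (n' + n') → mixedSpace (Fp L)), ℂ) | ∃ γ : (Fin (n' + n') × {v : InfinitePlace (Fp L) // v.IsReal}) →₀ ℕ, γ.degree ≤ D ∧
        follandHermite (GRConstruction.frameD L e' dV hdV hdV0 (tensorFrame L dW eW dV') (tensorFrame_real L dW hdW eW dV' hdV') (tensorFrame_ne_zero L dW eW dV' hdW0 hdV'0)) γ = x} := by
  -- the Hermite span of the frame is the image of the Fock-level Hermite span under the (injective, linear) frame transport `frameD^*⁻¹`
  have hset : {x : 𝓢((Fin (n' + n') → mixedSpace (Fp L)), ℂ) | ∃ γ : (Fin (n' + n') × {v : InfinitePlace (Fp L) // v.IsReal}) →₀ ℕ, γ.degree ≤ D ∧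
        follandHermite (GRConstruction.frameD L e' dV hdV hdV0 (tensorFrame L dW eW dV') (tensorFrame_real L dW hdW eW dV' hdV') (tensorFrame_ne_zero L dW eW dV' hdW0 hdV'0)) γ = x} =
      ((schwartzTransport (GRConstruction.frameD L e' dV hdV hdV0 (tensorFrame L dW eW dV') (tensorFrame_real L dW hdW eW dV' hdV')
          (tensorFrame_ne_zero L dW eW dV' hdW0 hdV'0))).symm.toLinearEquiv.toLinearMap) ''
        {x : SchwartzMap ((Fin (n' + n') × {v : InfinitePlace (Fp L) // v.IsReal}) → ℝ) ℂ |
          ∃ γ : (Fin (n' + n') × {v : InfinitePlace (Fp L) // v.IsReal}) →₀ ℕ, γ.degree ≤ D ∧ hermitePi γ = x} := by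
    ext x
    constructor
    · rintro ⟨γ, hγ, rfl⟩
      exact ⟨hermitePi γ, ⟨γ, hγ, rfl⟩, rfl⟩
    · rintro ⟨y, ⟨γ, hγ, rfl⟩, rfl⟩
      exact ⟨γ, hγ, rfl⟩
  rw [hset]
  exact (Submodule.apply_mem_span_image_iff_mem_span
    ((schwartzTransport (GRConstruction.frameD L e' dV hdV hdV0 (tensorFrame L dW eW dV') (tensorFrame_real L dW hdW eW dV' hdV')
      (tensorFrame_ne_zero L dW eW dV' hdW0 hdV'0))).symm.injective)).2 (binvPi_mem_span_hermitePi D _ hD)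

/-! ## §2 (dom) from the Hermite data -/

omit [Fintype P] [DecidableEq P] [Fintype Q] [DecidableEq Q] [∀ σ, Fintype (R σ)] [∀ σ, DecidableEq (R σ)] [∀ σ, Fintype (S σ)] [∀ σ, DecidableEq (S σ)] in
/-- **an arch datum for the CONCRETE doubled Weil representation IS arch-stable** (★ S2-D `IsArchDatum … (doubledWeilRep …) 𝒦 V` and ★ FaceGLetterDefs `IsArchStable … 𝒦 V` have the same
stability clause; definitional). [cite: HarrisKudlaSweet1996, §1 (1.15)–(1.17)] [cite: KudlaRallis1994, §1 Thm. 1.1] -/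
theorem isArchStable_of_isArchDatum (V : Submodule ℂ 𝓢(((Fin (n' + n')) → mixedSpace (Fp L)), ℂ))
    (hV : IsArchDatum L e dV hdV dW hdW eW e' dV' hdV'
      (doubledWeilRep L e' dV hdV hdV0 (tensorFrame L dW eW dV') (tensorFrame_real L dW hdW eW dV' hdV') (tensorFrame_ne_zero L dW eW dV' hdW0 hdV'0) χb hχbu hχbs) 𝒦 V) :
    IsArchStable L e dV hdV hdV0 dW hdW hdW0 eW e' dV' hdV' hdV'0 χb hχbu hχbs 𝒦 V :=
  hV.2

omit [Fintype P] [DecidableEq P] [Fintype Q] [DecidableEq Q] [∀ σ, Fintype (R σ)] [∀ σ, DecidableEq (R σ)] [∀ σ, Fintype (S σ)] [∀ σ, DecidableEq (S σ)] in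
/-- **(dom) FROM THE HERMITE DATA**: if every Hermite span `V_D` is an arch datum for `𝒦` (★ σ15 `isArchDatum_hermiteSpan … 𝒦 hK D`), then every finite set `s` of tuple vectors lies in a
finite-dimensional arch-stable subspace — `V′ := V_D`, `D := max_{β ∈ s} deg (tuplePoly β)` (§1).  Conclusion = ★ FILE 2b `good_tupleVec_of_frame`'s `hdom` binder bytes (at `P = Q = Fin 2`).
[cite: Folland1989, §4.2 Prop. (4.39)] [cite: Howe1989, §3] [cite: HarrisKudlaSweet1996, §1 (1.15)–(1.17)] -/
theorem hdom_of_hermiteData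
    (hdat : ∀ D : ℕ, IsArchDatum L e dV hdV dW hdW eW e' dV' hdV'
      (doubledWeilRep L e' dV hdV hdV0 (tensorFrame L dW eW dV') (tensorFrame_real L dW hdW eW dV' hdV') (tensorFrame_ne_zero L dW eW dV' hdW0 hdV'0) χb hχbu hχbs) 𝒦
      (Submodule.span ℂ {x : 𝓢((Fin (n' + n') → mixedSpace (Fp L)), ℂ) | ∃ γ : (Fin (n' + n') × {v : InfinitePlace (Fp L) // v.IsReal}) →₀ ℕ, γ.degree ≤ D ∧
        follandHermite (GRConstruction.frameD L e' dV hdV hdV0 (tensorFrame L dW eW dV') (tensorFrame_real L dW hdW eW dV' hdV') (tensorFrame_ne_zero L dW eW dV' hdW0 hdV'0)) γ = x})) :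
    ∀ s : Finset ((σ : {v : InfinitePlace (Fp L) // v.IsReal}) → MvPolynomial (DPIdx P Q (R σ) (S σ)) ℂ), ∃ V' : Submodule ℂ 𝓢(((Fin (n' + n')) → mixedSpace (Fp L)), ℂ),
      FiniteDimensional ℂ V' ∧ IsArchStable L e dV hdV hdV0 dW hdW hdW0 eW e' dV' hdV' hdV'0 χb hχbu hχbs 𝒦 V' ∧ ∀ β ∈ s, tupleVec L dV hdV hdV0 dW hdW hdW0 eW e' dV' hdV' hdV'0 R S eP eQ β ∈ V' := by
  intro s
  refine ⟨_, (hdat (s.sup fun β => (tuplePoly (fun σ => unitJunctionIdx ((P × R σ) ⊕ (Q × S σ)) ((P × S σ) ⊕ (Q × R σ)))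
      (frameSlotEquiv L dV hdV dW hdW eW e' dV' hdV' R S eP eQ) β).totalDegree)).1,
    isArchStable_of_isArchDatum L e dV hdV hdV0 dW hdW hdW0 eW e' dV' hdV' hdV'0 χb hχbu hχbs 𝒦 _ (hdat _), fun β hβ => ?_⟩
  exact tupleVec_mem_hermiteSpan L dV hdV hdV0 dW hdW hdW0 eW e' dV' hdV' hdV'0 R S eP eQ β _
    (Finset.le_sup (f := fun β => (tuplePoly (fun σ => unitJunctionIdx ((P × R σ) ⊕ (Q × S σ)) ((P × S σ) ⊕ (Q × R σ)))
      (frameSlotEquiv L dV hdV dW hdW eW e' dV' hdV' R S eP eQ) β).totalDegree) hβ)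

/-! ## §3 (vac) at the hol cut of record `V₀ = ℂ ∙ v_G` -/

omit [Fintype P] [DecidableEq P] [Fintype Q] [DecidableEq Q] [∀ σ, Fintype (R σ)] [∀ σ, DecidableEq (R σ)] [∀ σ, Fintype (S σ)] [∀ σ, DecidableEq (S σ)] in
/-- **THE ALL-VACUUM TUPLE VECTOR IS `v_G` OF RECORD**: `tupleVec 1 = archGaussianOfRecord` (★ FILE 1 `tupleVecOf_one`: `= frameD^*⁻¹ h₀ = follandHermite frameD 0`; ★ LH7-p05
`archGaussianOfRecord_eq_follandHermite`, `rfl`). [cite: Folland1989, §1.7 (1.81), §4.2 Prop. (4.39)] -/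
theorem tupleVec_one_eq_archGaussianOfRecord :
    tupleVec L dV hdV hdV0 dW hdW hdW0 eW e' dV' hdV' hdV'0 R S eP eQ (fun _ => (1 : MvPolynomial (DPIdx P Q (R _) (S _)) ℂ)) =
      archGaussianOfRecord L dV hdV hdV0 dW hdW hdW0 eW e' dV' hdV' hdV'0 := by
  unfold tupleVec
  rw [tupleVecOf_one]
  rfl

omit [IsCMField L] in
/-- **THE DEGREE-ZERO HERMITE SPAN IS THE GAUSSIAN LINE**: `span {follandHermite e γ : |γ| ≤ 0} = ℂ ∙ follandHermite e 0` (`|γ| ≤ 0 ⇔ γ = 0`, `Finsupp.degree_eq_zero_iff`). [folklore] -/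
theorem hermiteSpan_zero_eq_span {ι : Type} [Fintype ι] [DecidableEq ι] {Dc : Type} [NormedAddCommGroup Dc] [NormedSpace ℝ Dc] (ef : Dc ≃L[ℝ] (ι → ℝ)) :
    Submodule.span ℂ {x : 𝓢(Dc, ℂ) | ∃ γ : ι →₀ ℕ, γ.degree ≤ 0 ∧ follandHermite ef γ = x} = ℂ ∙ follandHermite ef 0 := by
  congr 1
  ext x
  constructor
  · rintro ⟨γ, hγ, rfl⟩
    obtain rfl : γ = 0 := (Finsupp.degree_eq_zero_iff γ).1 (Nat.le_zero.1 hγ)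
    exact Set.mem_singleton _
  · rintro rfl
    exact ⟨0, by rw [map_zero], rfl⟩

omit [Fintype P] [DecidableEq P] [Fintype Q] [DecidableEq Q] [∀ σ, Fintype (R σ)] [∀ σ, DecidableEq (R σ)] [∀ σ, Fintype (S σ)] [∀ σ, DecidableEq (S σ)] in
/-- **(vac) AT THE HOL CUT OF RECORD FROM THE HERMITE DATA**: if the degree-zero Hermite span is an arch datum for `𝒦` (`hdat 0` of §2; ★ σ15 at `D := 0`), then `V₀ := ℂ ∙ v_G` is
finite-dimensional, arch-stable, IS the hol cut of record (★ LH7-p05 `HLrecOfRecord … V₀` = `holCutOfRecord … V₀`, i.e. `V₀ = ℂ ∙ archGaussianOfRecord …`, `rfl`) and contains the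
all-vacuum tuple vector `tupleVec 1 = v_G`.  Conclusion = ★ FILE 2b `vac_good_of_base`'s `hHL` ∕ `good_tupleVec_of_frame`'s (vac)-domain bytes at `HL₀ := HLrecOfRecord …`.
[cite: Liu2021, App. B proof of Prop. B.8 pp. 103–106] [cite: Folland1989, §4.2 Prop. (4.39)] [cite: KudlaRallis1994, §3] -/
theorem hHL_of_hermiteData
    (hdat0 : IsArchDatum L e dV hdV dW hdW eW e' dV' hdV'
      (doubledWeilRep L e' dV hdV hdV0 (tensorFrame L dW eW dV') (tensorFrame_real L dW hdW eW dV' hdV') (tensorFrame_ne_zero L dW eW dV' hdW0 hdV'0) χb hχbu hχbs) 𝒦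
      (Submodule.span ℂ {x : 𝓢((Fin (n' + n') → mixedSpace (Fp L)), ℂ) | ∃ γ : (Fin (n' + n') × {v : InfinitePlace (Fp L) // v.IsReal}) →₀ ℕ, γ.degree ≤ 0 ∧
        follandHermite (GRConstruction.frameD L e' dV hdV hdV0 (tensorFrame L dW eW dV') (tensorFrame_real L dW hdW eW dV' hdV') (tensorFrame_ne_zero L dW eW dV' hdW0 hdV'0)) γ = x})) :
    ∃ V₀ : Submodule ℂ 𝓢(((Fin (n' + n')) → mixedSpace (Fp L)), ℂ), FiniteDimensional ℂ V₀ ∧ IsArchStable L e dV hdV hdV0 dW hdW hdW0 eW e' dV' hdV' hdV'0 χb hχbu hχbs 𝒦 V₀ ∧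
      HLrecOfRecord L dV hdV hdV0 dW hdW hdW0 eW e' dV' hdV' hdV'0 V₀ ∧
      tupleVec L dV hdV hdV0 dW hdW hdW0 eW e' dV' hdV' hdV'0 R S eP eQ (fun _ => (1 : MvPolynomial (DPIdx P Q (R _) (S _)) ℂ)) ∈ V₀ := by
  have h0 := hermiteSpan_zero_eq_span (GRConstruction.frameD L e' dV hdV hdV0 (tensorFrame L dW eW dV') (tensorFrame_real L dW hdW eW dV' hdV')
    (tensorFrame_ne_zero L dW eW dV' hdW0 hdV'0))
  rw [h0] at hdat0
  refine ⟨ℂ ∙ archGaussianOfRecord L dV hdV hdV0 dW hdW hdW0 eW e' dV' hdV' hdV'0, hdat0.1,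
    isArchStable_of_isArchDatum L e dV hdV hdV0 dW hdW hdW0 eW e' dV' hdV' hdV'0 χb hχbu hχbs 𝒦 _ hdat0, rfl, ?_⟩
  rw [tupleVec_one_eq_archGaussianOfRecord]
  exact Submodule.mem_span_singleton_self _

end BigDatum

end Summit.HodgeConjecture.HodgeConjecture.Cruxes.HLiu418.K2LiuArchSWDataDomainLetters

end
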